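import Summits.BirchSwinnertonDyer.Rank1Residual.X2.CellCBDPValueLZZRoadInput
import HarnessLib

/-!
# X2c at `p ‖ N` (either sign; every odd `p`, aimed at `p = 3`), road LZZ IN THE KERNEL, part 2: the KERNEL RESCALE
# `LZZRoadInput ⟹ X2.BDPValueContinuousDisplayAt W p` — virtual periods absorbing every geometric factor, the
# factor ledger `𝔠 = ±2⁵g/(w_K²√δ_K c_M²)`, `‖𝔠‖_p = 1` —, hence `stub_c2` of crux 4 BY NAME (cell `bsd-eis`, seat
# `bsd-eis-cgshw` g14; route `EisensteinPrimes`, crux 4 `BSDpOnCellC` = stmt-BirchSwinnertonDyer-19034, line b1 v9;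
# RULING L43 (2) «COMMISSION (O2)-LZZ@3», kernel side; MEMO-18 §5)

HONEST FRAMING (cell `bsd-eis`, run/shared/lean/pub/bsd-eis/): THEOREMS ONLY (the rescale; 0 sorry); nothing booked;
X2 stays CONSTRUCTION-SHAPED; no label or count moves; BSD is not proved by any of this. Everything is CONDITIONAL on
the typed input `X2.LZZRoadInput` (part 1, `X2/CellCBDPValueLZZRoadInput.lean`: LZZ18 Thm. 3.8 ∧ 3.10 ∧ Prop. 4.12
in tree currency with readings and the (L5)/(L6) identities as clauses — NOT in print in this currency; the typist's
Literature filing is to imply it).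

## The rescale (`exists_continuousDisplay_of_lzzRoadInput`; MEMO-18 §5 lemmas 1–7)

With `Ω_K := 1`: `X_k·M_k = Y_k` in `ℂ` (`Γ(n)Γ(n+1) = (n−1)!n!`; `X_k` Castella's display numerator, `Y_k` LZZ's value,
`M_k = [K₀C₁π(−a_p)/g]·[gζζπ²]^n·χ^{(ι)}(t)·φ(ϖ_𝔭)` — `lzz_display_term_identity`); all `n`-dependence of
`ι⁻¹M_k` is `λ^n·(→1)` with `λ = ι⁻¹(gζζπ²)·ϖ/τ`; `Ω_p := λ^{1/4}` (`ℚ̄_p` algebraically closed) kills it; the display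
becomes `𝓛(χ_k)·c₁⁻¹·(r_k(σt)r_k(σ𝔭))⁻¹ → a_0·c₁⁻¹` (`X2.tendsto_value_of_tendsto_zero_of_coeff_bound`, uniform
convergence of avatars `eventually_forall_norm_avatarValueAt_sub_one_lt`); (L2)+(L5)+(L6) give `a_0·c₁⁻¹ = u·V`
with `u = s₂·ι⁻¹(32g/(sC·c_M²·w_K²·√δ_K))·ι⁻¹(ξ)⁻¹` (`lzz_unit_identity`; c2v MEMO-2 §3) and `‖u‖ = 1` from `p` odd, `‖ι⁻¹ξ‖ = 1`,
`w_K = 2` (`d_K < −4`, `Quadratic.torsionOrder_eq_two_of_discr_lt_neg_four`), `p ∤ d_K` (Heegner at `p ∣ N`,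
`Literature.SatisfiesHeegnerHypothesis.not_dvd_discr`), `p ∤ c_M` (binder).

What this is NOT: not a value theorem at `3 ‖ N` by itself (the input is a hypothesis); not a Literature filing;
no census move until the typist's fact lands and the referee passes the clauses of `LZZRoadInput`. With part 1 and
p502241/p503213 the chain is: FACT-LZZ (littype) ⟹ `LZZRoadInput` ⟹ `BDPValueContinuousDisplayAt W 3`
(`bdpValueContinuousDisplayAt_of_lzzRoadInput`) ⟹ `stub_c2` (`Reoriented.stub_c2_of_continuousDisplay_three`) ⟹
the ψ-even door «literal on Keller–Yin Thm. D alone» (`Reoriented.bsdpOnCellCNotGV_of_continuousDisplay_three_of_thmD_OPEN`).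

References: [LiuZhangZhang2018] Thm. 3.8, Thm. 3.10, Prop. 4.12 (arXiv:1511.08172 pp. 18, 23) and the locators of part 1;
[Washington1997] §7.1; c2v MEMO-1/2; cgshw MEMO-18.
-/

set_option autoImplicit false

noncomputable section

open scoped Classical MatrixGroups ModularForm Topology

open Filter CongruenceSubgroup WeierstrassCurve NumberField IsDedekindDomain Field PowerSeries
  Literature.NumberTheory.EllipticCurves Literature.NumberTheory.EllipticCurves.GreenbergSelmer
  Literature.NumberTheory.EllipticCurves.ModularForms
  Literature.NumberTheory.EllipticCurves.Rank1Residual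
  Literature.NumberTheory.EllipticCurves.Rank1Residual.Typed
  Literature.NumberTheory.GaloisRepresentations Literature.NumberTheory.GaloisCohomology
  Literature.NumberTheory.Automorphic
  Summit.BirchSwinnertonDyer.Rank1Residual.X11b.AcSelmer
  Summit.BirchSwinnertonDyer.Rank1Residual.X11b.Halves
  Summit.BirchSwinnertonDyer.Rank1Residual.X11b

namespace Summit.BirchSwinnertonDyer.Rank1Residual.X2
/-! ### §3 The rescale: `LZZRoadInput ⟹` the pointwise contract `⟹ BDPValueContinuousDisplayAt` -/

section Rescale

variable {p : ℕ} [Fact p.Prime]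

/-- **The kernel rescale (MEMO-18 §5): `LZZRoadInput` ⟹ the POINTWISE CONTRACT of
`X2.bdpValueContinuousDisplayAt_of_pointwise`** at every datum (any odd `p ‖ N`; `d_K < −4`). Virtual periods:
`Ω_K := 1`, `Ω_p := λ^{1/4}` with `λ = ι⁻¹(gζζπ²)·ϖ/τ` (all geometric `n`-dependence), unit
`u = s₂·ι⁻¹(32g/(sC·c_M²·4·√δ_K))·ι⁻¹(ξ)⁻¹` (`w_K = 2`). Proof: module docstring («The rescale»). CONDITIONAL on
`LZZRoadInput` (typed input, NOT in print in this currency); nothing booked.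
[cite: LiuZhangZhang2018, Thm. 3.8 and Thm. 3.10 and Prop. 4.12 (arXiv:1511.08172 pp. 18, 23) (source of the input; nothing asserted)]
[cite: Washington1997, §7.1] -/
theorem exists_continuousDisplay_of_lzzRoadInput (hL : LZZRoadInput)
    (ι : PadicAlgCl p ≃+* ℂ) (W : WeierstrassCurve ℚ) [W.IsElliptic] [W.IsGloballyMinimal]
    (K : Type) [Field K] [NumberField K] (𝔭 : HeightOneSpectrum (𝓞 K))
    (κ : ZpExtension K p) (γ : absoluteGaloisGroup K) {N : ℕ} [NeZero N]
    (Dt : ModularParametrizationData W N) (H : HeegnerDatum N (NumberField.discr K))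
    (ιK : K →+* ℂ) (e : K →+* ℚ_[p]) (P : (W.baseChange K).toAffine.Point)
    (f : CuspForm (CongruenceSubgroup.Gamma0 N) 2)
    (hp2 : p ≠ 2) (hmult : W.HasMultiplicativeReductionAtPrime p) (hN : W.conductorNorm ℤ = N)
    (hpN : p ∣ N) (hp2N : ¬ p ^ 2 ∣ N) (hK : IsImaginaryQuadratic K) (hd4 : NumberField.discr K < -4)
    (hsplit : ((Ideal.span {(p : ℤ)}).primesOver (𝓞 K)).ncard = 2)
    (h𝔭 : ((p : ℕ) : 𝓞 K) ∈ 𝔭.asIdeal)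
    (hι : ∀ (w' : InfinitePlace K) (k : 𝓞 K), k ∈ 𝔭.asIdeal ↔ ‖ι.symm (w'.embedding (k : K))‖ < 1)
    (hHN : SatisfiesHeegnerHypothesis N K) (hκ : κ.IsAnticyclotomic) (hγ : κ.IsTopGenerator γ)
    (hfW : IsNewformOf W f) (hcM : ¬ (p : ℤ) ∣ Dt.c)
    (hP : WeierstrassCurve.Affine.Point.map ιK.toRatAlgHom P = heegnerPointComplex Dt H)
    (he : ∀ k : 𝓞 K, k ∈ 𝔭.asIdeal ↔ ‖e (k : K)‖ < 1) :
    ∃ (ΩK : ℂ) (Ωp u : ℂ_[p]), ΩK ≠ 0 ∧ Ωp ≠ 0 ∧ ‖u‖ = 1 ∧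
      ∀ (φ : ℕ → HeckeCharacter K) (n : ℕ → ℕ) (r : ℕ → FramedGaloisRep K (PadicAlgCl p) 1),
        (∀ k, 0 < n k) → (∀ k (v : HeightOneSpectrum (𝓞 K)), (φ k).IsUnramifiedAt v) →
        (∀ k, (φ k).HasInfinityType (fun _ ↦ (n k : ℤ)) (fun _ ↦ -(n k : ℤ))) →
        (∀ k, IsPAdicAvatarOf ι (φ k) (r k)) → (∀ k, FactorsThroughZp κ (r k)) →
        Tendsto (fun k ↦ avatarValueAt (r k) γ) atTop (𝓝 1) →
        Tendsto (fun k ↦ ((ι.symm (bdpInterpolationValue p f 𝔭 (φ k) (n k) ΩK) :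
          PadicAlgCl p) : ℂ_[p]) * Ωp ^ (4 * n k)) atTop
          (𝓝 (u * (algebraMap ℚ_[p] ℂ_[p] (((1 : ℚ_[p]) - ((W.LFunction p : ℤ) : ℚ_[p]) *
            (p : ℚ_[p])⁻¹) * Castella2018.padicLogOmega W p e P)) ^ 2)) := by
  have hp : p.Prime := Fact.out
  obtain ⟨a, ζζ, ξ, C₁, L1η, A₀, Pet, LAd, B, aSM, sG, sC, s₂, ϖ, τ, σt, σ𝔭, hrad, hC₁, hζζ0, hξ1, hL1η, hA₀,
    hPet, hLAd, hB, hτ, hϖ, hsG, hsC, hs₂, hcnf, hCol, hTam, hL1, hL2⟩ :=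
    hL ι W K 𝔭 κ γ Dt H ιK e P f hN hpN hp2N hK hsplit h𝔭 hι hHN hκ hγ hfW hP he
  -- the embedding `ι⁻¹ : ℂ → ℂ_p` as a ring map
  set em : ℂ →+* ℂ_[p] := (algebraMap (PadicAlgCl p) ℂ_[p]).comp ι.symm.toRingHom with hem
  have hem' : ∀ z : ℂ, ((ι.symm z : PadicAlgCl p) : ℂ_[p]) = em z := fun z ↦ rfl
  have hemι : ∀ x : PadicAlgCl p, em (ι x) = (x : ℂ_[p]) := by
    intro x
    rw [← hem', RingEquiv.symm_apply_apply]
  -- complex constants and their non-vanishing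
  have hπ0 : (Real.pi : ℂ) ≠ 0 := by exact_mod_cast Real.pi_ne_zero
  set δs : ℂ := (Real.sqrt |(NumberField.discr K : ℝ)| : ℂ) with hδs
  have hδs0 : δs ≠ 0 := by
    have hd : (0 : ℝ) < |(NumberField.discr K : ℝ)| :=
      abs_pos.mpr (by exact_mod_cast NumberField.discr_ne_zero K)
    rw [hδs, Ne, Complex.ofReal_eq_zero]
    exact (Real.sqrt_pos.mpr hd).ne'
  have hL1η0 : (L1η : ℂ) ≠ 0 := by exact_mod_cast hL1η.ne'
  have hLAd0 : (LAd : ℂ) ≠ 0 := by exact_mod_cast hLAd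
  have hC₁0 : (C₁ : ℂ) ≠ 0 := by exact_mod_cast hC₁
  have hA₀0 : (A₀ : ℂ) ≠ 0 := by exact_mod_cast hA₀.ne'
  have hB0 : (B : ℂ) ≠ 0 := by exact_mod_cast hB.ne'
  have hPet0 : (Pet : ℂ) ≠ 0 := by exact_mod_cast hPet.ne'
  have hsG0 : (sG : ℂ) ≠ 0 := by rcases hsG with h | h <;> simp [h]
  have hsC0 : (sC : ℂ) ≠ 0 := by rcases hsC with h | h <;> simp [h]
  set gc : ℂ := (sG : ℂ) * (2 : ℂ) ^ aSM with hgc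
  have hgc0 : gc ≠ 0 := mul_ne_zero hsG0 (zpow_ne_zero _ two_ne_zero)
  -- the χ-independent unit `ξ`
  have hξe0 : ((ι.symm ξ : PadicAlgCl p) : ℂ_[p]) ≠ 0 := fun h0 ↦ by
    rw [h0, norm_zero] at hξ1; exact zero_ne_one hξ1
  have hξ0 : ξ ≠ 0 := by
    intro h0; apply hξe0; rw [h0, map_zero]; rfl
  set Kc : ℂ := (Real.pi : ℂ) * ((Real.pi : ℂ) ^ 2 / 6) / (4 * δs * (L1η : ℂ) ^ 2 * (LAd : ℂ))
    with hKc
  have hKc0 : Kc ≠ 0 := by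
    rw [hKc]
    refine div_ne_zero (mul_ne_zero hπ0 (div_ne_zero (pow_ne_zero _ hπ0) (by norm_num))) ?_
    exact mul_ne_zero (mul_ne_zero (mul_ne_zero (by norm_num) hδs0) (pow_ne_zero _ hL1η0)) hLAd0
  -- `a_p(f) = a_p(E) = ±1`
  set ap : ℂ := cuspCoeff f p with hap
  have hapW : ap = ((W.LFunction p : ℤ) : ℂ) := hfW.2 p
  have haW0 : (W.LFunction p : ℤ) ≠ 0 := by
    intro h0
    exact X11b.R1.not_dvd_lFunction_of_mult hfW hmult (by rw [h0]; exact dvd_zero _)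
  have hap0 : ap ≠ 0 := by rw [hapW]; exact_mod_cast haW0
  -- `ψ(N) > 0`
  set ψN : ℝ := (N : ℝ) * ∏ q ∈ N.primeFactors, (1 + ((q : ℝ))⁻¹) with hψN
  have hψNpos : 0 < ψN := by
    rw [hψN]
    refine mul_pos (by exact_mod_cast Nat.pos_of_ne_zero (NeZero.ne N)) ?_
    exact Finset.prod_pos fun q _ ↦ by positivity
  have hψN0 : (ψN : ℂ) ≠ 0 := by exact_mod_cast hψNpos.ne'
  -- `p`-adic constants
  set τ' : PadicAlgCl p := algebraMap ℚ_[p] (PadicAlgCl p) τ with hτ'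
  set ϖ' : PadicAlgCl p := algebraMap ℚ_[p] (PadicAlgCl p) ϖ with hϖ'
  have hτ'0 : τ' ≠ 0 := by
    rw [hτ']; exact (map_ne_zero_iff _ (algebraMap ℚ_[p] (PadicAlgCl p)).injective).mpr hτ
  have hpQ : (p : ℚ_[p]) ≠ 0 := by exact_mod_cast hp.ne_zero
  have hϖ0 : ϖ ≠ 0 := by
    rcases hϖ with h | h
    · rw [h]; exact hpQ
    · rw [h]; exact inv_ne_zero hpQ
  have hϖ'0 : ϖ' ≠ 0 := by
    rw [hϖ']; exact (map_ne_zero_iff _ (algebraMap ℚ_[p] (PadicAlgCl p)).injective).mpr hϖ0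
  set μ : PadicAlgCl p := ι.symm (gc * ζζ * (Real.pi : ℂ) ^ 2) with hμ
  have hμ0 : μ ≠ 0 := by
    rw [hμ]
    exact (map_ne_zero_iff _ ι.symm.injective).mpr
      (mul_ne_zero (mul_ne_zero hgc0 hζζ0) (pow_ne_zero _ hπ0))
  set lam : PadicAlgCl p := μ * ϖ' / τ' with hlam
  have hlam0 : lam ≠ 0 := div_ne_zero (mul_ne_zero hμ0 hϖ'0) hτ'0
  obtain ⟨ω, hω⟩ := IsAlgClosed.exists_pow_nat_eq lam (by norm_num : 0 < 4)
  have hω0 : ω ≠ 0 := fun h0 ↦ hlam0 (by rw [← hω, h0]; norm_num)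
  -- the constant `c = K·C₁·π·(−a_p)/g`
  set cC : ℂ := ξ * Kc * (C₁ : ℂ) * (Real.pi : ℂ) * (-ap) / gc with hcC
  have hcC0 : cC ≠ 0 :=
    div_ne_zero (mul_ne_zero (mul_ne_zero (mul_ne_zero (mul_ne_zero hξ0 hKc0) hC₁0) hπ0)
      (neg_ne_zero.mpr hap0)) hgc0
  -- `w_K = 2`, `p ∤ d_K`
  have hw2 : NumberField.Units.torsionOrder K = 2 :=
    Literature.NumberTheory.QuadraticFields.Quadratic.torsionOrder_eq_two_of_discr_lt_neg_four hK.1 hd4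
  have hdisc : ¬ (p : ℤ) ∣ NumberField.discr K :=
    Literature.SatisfiesHeegnerHypothesis.not_dvd_discr hK.1 hHN hp hpN
  -- the unit `u`
  set u : ℂ_[p] := (s₂ : ℂ_[p]) *
    em (32 * gc / ((sC : ℂ) * ((Dt.c : ℤ) : ℂ) ^ 2 * (2 : ℂ) ^ 2 * δs)) * (em ξ)⁻¹ with hu
  have h2unit : ‖em (2 : ℂ)‖ = 1 := by
    rw [show (2 : ℂ) = ((2 : ℕ) : ℂ) by norm_num]
    exact PNewDisplay.norm_map_natCast_eq_one em
      (fun h ↦ hp2 ((Nat.prime_dvd_prime_iff_eq hp Nat.prime_two).mp h))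
  have h32 : ‖em (32 : ℂ)‖ = 1 := by
    rw [show (32 : ℂ) = 2 ^ 5 by norm_num, map_pow, norm_pow, h2unit, one_pow]
  have hsG1 : ‖em (sG : ℂ)‖ = 1 := by rcases hsG with h | h <;> simp [h]
  have hgc1 : ‖em gc‖ = 1 := by
    rw [hgc, map_mul, map_zpow₀, norm_mul, norm_zpow, h2unit, one_zpow, mul_one, hsG1]
  have hξ1' : ‖em ξ‖ = 1 := by rw [← hem']; exact hξ1
  have hsC1 : ‖em (sC : ℂ)‖ = 1 := by rcases hsC with h | h <;> simp [h]
  have hcM1 : ‖em ((Dt.c : ℤ) : ℂ)‖ = 1 := norm_map_intCast_eq_one em hcM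
  have hδs1 : ‖em δs‖ = 1 := PNewDisplay.norm_map_sqrt_discr_eq_one em hdisc
  have hs₂1 : ‖(s₂ : ℂ_[p])‖ = 1 := by rcases hs₂ with h | h <;> simp [h]
  have hu1 : ‖u‖ = 1 := by
    rw [hu, norm_mul, norm_mul, norm_inv, hξ1', hs₂1, map_div₀, norm_div, map_mul, norm_mul, h32,
      hgc1, map_mul, map_mul, map_mul, norm_mul, norm_mul, norm_mul, hsC1, map_pow, norm_pow, hcM1,
      map_pow, norm_pow, h2unit, hδs1]
    norm_num
  have hωC0 : (ω : ℂ_[p]) ≠ 0 := by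
    rw [← hemι]; exact (map_ne_zero em).mpr ((map_ne_zero_iff _ ι.injective).mpr hω0)
  refine ⟨1, (ω : ℂ_[p]), u, one_ne_zero, hωC0, hu1, ?_⟩
  intro φ n r hn hunr hinf hav hfac hlimγ
  have hL1k := fun k ↦ hL1 (φ k) (n k) (r k) (hn k) (hunr k) (hinf k) (hav k) (hfac k)
  -- uniform convergence of the avatars at every `σ`
  have hσ : ∀ σ : absoluteGaloisGroup K, Tendsto (fun k ↦ avatarValueAt (r k) σ) atTop (𝓝 1) := by
    intro σ
    rw [Metric.tendsto_nhds]
    intro ε hε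
    filter_upwards [PNewDisplay.eventually_forall_norm_avatarValueAt_sub_one_lt hγ hfac hlimγ hε] with k hk
    rw [dist_eq_norm]
    exact hk σ
  -- the LZZ values `𝓛(χ_k)` and their limit `𝓛(𝟙) = a 0` ((L3′) + open-disc continuity)
  set Lval : ℕ → ℂ_[p] := fun k ↦ ((ι.symm (ξ *
      rankinSelbergValueHecke f (φ k) 1 * Kc *
      ((C₁ : ℂ) * (Complex.Gamma (n k : ℂ) * Complex.Gamma ((n k : ℂ) + 1)) *
        gc ^ (n k - 1) * ζζ ^ (n k) *
        ι (((Matrix.GeneralLinearGroup.det (r k σt) : (PadicAlgCl p)ˣ) : PadicAlgCl p) *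
          (τ' ^ (n k))⁻¹)) *
      (-ap * heckeValueExtZero (φ k) 𝔭 *
        (1 - ap * ((p : ℂ))⁻¹ * heckeValueExtZero (φ k) 𝔭) ^ 2)) : PadicAlgCl p) : ℂ_[p])
    with hLval
  have hv : ∀ k, HasSum (fun m ↦ a m * (avatarValueAt (r k) γ - 1) ^ m) (Lval k) :=
    fun k ↦ (hL1k k).2
  obtain ⟨C, hC⟩ := hrad (1 / 2) (by norm_num)
  have hx : Tendsto (fun k ↦ avatarValueAt (r k) γ - 1) atTop (𝓝 0) := by
    have h := hlimγ.sub_const 1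
    rwa [sub_self] at h
  have hlimL : Tendsto Lval atTop (𝓝 (a 0)) :=
    tendsto_value_of_tendsto_zero_of_coeff_bound (ρ := 1 / 2) (by norm_num) hC hx hv
  -- the per-character identity: display = 𝓛(χ_k) · c⁻¹ · (r_k(σt) r_k(σ𝔭))⁻¹
  have hterm : ∀ k, ((ι.symm (bdpInterpolationValue p f 𝔭 (φ k) (n k) 1) : PadicAlgCl p) : ℂ_[p]) *
      (ω : ℂ_[p]) ^ (4 * n k) =
      Lval k * (em cC)⁻¹ * (avatarValueAt (r k) σt * avatarValueAt (r k) σ𝔭)⁻¹ := by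
    intro k
    obtain ⟨m, hm⟩ := Nat.exists_eq_add_one_of_ne_zero (hn k).ne'
    set dT : PadicAlgCl p := ((Matrix.GeneralLinearGroup.det (r k σt) : (PadicAlgCl p)ˣ) :
      PadicAlgCl p) with hdT
    set dP : PadicAlgCl p := ((Matrix.GeneralLinearGroup.det (r k σ𝔭) : (PadicAlgCl p)ˣ) :
      PadicAlgCl p) with hdP
    have hdT0 : dT ≠ 0 := Units.ne_zero _
    have hdP0 : dP ≠ 0 := Units.ne_zero _
    have havT : avatarValueAt (r k) σt = (dT : ℂ_[p]) := rfl
    have havP : avatarValueAt (r k) σ𝔭 = (dP : ℂ_[p]) := rfl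
    -- (AV-p) read in `ℂ`
    have hAV := (hL1k k).1
    rw [hm] at hAV
    have hφ𝔭 : heckeValueExtZero (φ k) 𝔭 = ι ϖ' ^ (m + 1) * ι dP := by
      rw [← map_pow, ← map_mul, ← hAV, RingEquiv.apply_symm_apply]
    -- `Ω⁴` read in `ℂ`
    have hOm : ι ω ^ 4 = gc * ζζ * (Real.pi : ℂ) ^ 2 * ι ϖ' / ι τ' := by
      rw [← map_pow, hω, hlam, map_div₀, map_mul, hμ, RingEquiv.apply_symm_apply]
    have hιdT : ι dT ≠ 0 := (map_ne_zero_iff _ ι.injective).mpr hdT0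
    have hιdP : ι dP ≠ 0 := (map_ne_zero_iff _ ι.injective).mpr hdP0
    have hιτ : ι τ' ≠ 0 := (map_ne_zero_iff _ ι.injective).mpr hτ'0
    have key := lzz_display_term_identity ξ (rankinSelbergValueHecke f (φ k) 1) Kc (C₁ : ℂ)
      (Complex.Gamma ((m + 1 : ℕ) : ℂ) * Complex.Gamma (((m + 1 : ℕ) : ℂ) + 1)) gc ζζ
      (Real.pi : ℂ) ap ((p : ℂ))⁻¹ (ι dT) (ι τ') (ι ϖ') (ι dP) (ι ω) m hξ0 hKc0 hC₁0 hπ0 hap0 hιdT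
      hιτ hιdP hOm
    -- rewrite the goal as `em` of the complex identity
    simp only [hLval, hm, Nat.add_sub_cancel]
    rw [hem', hem', havT, havP, ← hemι ω, ← hemι dT, ← hemι dP, bdpInterpolationValue_of_dvd hpN,
      hφ𝔭, map_mul ι dT, map_inv₀, map_pow, ← map_pow em, ← map_mul em, key, hcC]
    simp only [map_mul, map_inv₀]
  -- the limit
  have hlim : Tendsto (fun k ↦ Lval k * (em cC)⁻¹ *
      (avatarValueAt (r k) σt * avatarValueAt (r k) σ𝔭)⁻¹) atTop
      (𝓝 (a 0 * (em cC)⁻¹ * ((1 : ℂ_[p]) * 1)⁻¹)) :=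
    (hlimL.mul tendsto_const_nhds).mul (((hσ σt).mul (hσ σ𝔭)).inv₀ (by norm_num))
  have hfun : (fun k ↦ ((ι.symm (bdpInterpolationValue p f 𝔭 (φ k) (n k) 1) : PadicAlgCl p) :
      ℂ_[p]) * (ω : ℂ_[p]) ^ (4 * n k)) = (fun k ↦ Lval k * (em cC)⁻¹ *
      (avatarValueAt (r k) σt * avatarValueAt (r k) σ𝔭)⁻¹) := funext hterm
  rw [hfun]
  convert hlim using 2
  -- the value: `u·V² = a 0 · c⁻¹` from (L2), (L5), (L6)
  simp only [mul_one, inv_one]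
  have hh0 : (NumberField.classNumber K : ℂ) ≠ 0 := by
    exact_mod_cast (NumberField.classNumber_pos (K := K)).ne'
  have hcMC0 : ((Dt.c : ℤ) : ℂ) ≠ 0 := by
    have : (Dt.c : ℤ) ≠ 0 := fun h0 ↦ hcM (by rw [h0]; exact dvd_zero _)
    exact_mod_cast this
  have hcnf' : (L1η : ℂ) = 2 * (Real.pi : ℂ) * (NumberField.classNumber K : ℂ) / ((2 : ℂ) * δs) := by
    rw [hcnf, hw2, hδs]; push_cast; ring
  have hCol' : (LAd : ℂ) = 8 * (Real.pi : ℂ) ^ 3 * (Pet : ℂ) * (B : ℂ) / (ψN : ℂ) := by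
    rw [hCol, hψN]; push_cast; ring
  have hTam' : (C₁ : ℂ) * (A₀ : ℂ) =
      (sC : ℂ) * (24 * (Real.pi : ℂ) * ((Dt.c : ℤ) : ℂ) ^ 2 * (Pet : ℂ) / (ψN : ℂ)) := by
    have h := congrArg (fun x : ℝ ↦ (x : ℂ)) hTam
    push_cast at h ⊢; linear_combination h
  -- the complex unit identity (c2v MEMO-2 §3) and its image under `em`
  set Q : ℂ := 32 * gc / ((sC : ℂ) * ((Dt.c : ℤ) : ℂ) ^ 2 * (2 : ℂ) ^ 2 * δs) with hQ
  have hunitC : Q * ((A₀ : ℂ) * (B : ℂ)) * Kc * (C₁ : ℂ) * (Real.pi : ℂ) / gc *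
      (NumberField.classNumber K : ℂ) ^ 2 = 1 :=
    lzz_unit_identity gc (sC : ℂ) ((Dt.c : ℤ) : ℂ) 2 δs (A₀ : ℂ) (B : ℂ) Kc (C₁ : ℂ) (Real.pi : ℂ)
      (NumberField.classNumber K : ℂ) (Pet : ℂ) (ψN : ℂ) (LAd : ℂ) (L1η : ℂ) hgc0 hsC0 hcMC0
      two_ne_zero hδs0 hA₀0 hB0 hπ0 hh0 hPet0 hψN0 hKc hcnf' hCol' hTam'
  set E3 : ℂ := Kc * (C₁ : ℂ) * (Real.pi : ℂ) / gc with hE3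
  have hunit' : em Q * em ((A₀ : ℂ) * (B : ℂ)) * em E3 *
      (em (NumberField.classNumber K : ℂ)) ^ 2 = 1 := by
    rw [← map_pow, ← map_mul, ← map_mul, ← map_mul,
      show Q * ((A₀ : ℂ) * (B : ℂ)) * E3 * (NumberField.classNumber K : ℂ) ^ 2 =
        Q * ((A₀ : ℂ) * (B : ℂ)) * Kc * (C₁ : ℂ) * (Real.pi : ℂ) / gc *
          (NumberField.classNumber K : ℂ) ^ 2 by rw [hE3]; ring, hunitC, map_one]
  have hξem0 : em ξ ≠ 0 := (map_ne_zero em).mpr hξ0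
  -- `p`-adic atoms
  set aW : ℚ_[p] := ((W.LFunction p : ℤ) : ℚ_[p]) with haW
  set hQn : ℚ_[p] := (NumberField.classNumber K : ℚ_[p]) with hhQn
  set Lg : ℚ_[p] := Castella2018.padicLogOmega W p e P with hLg
  set F : ℚ_[p] := ((1 : ℚ_[p]) - aW * (p : ℚ_[p])⁻¹) ^ 2 with hF
  have haWQ0 : aW ≠ 0 := by rw [haW]; exact_mod_cast haW0
  have hF0 : F ≠ 0 := by
    rw [hF]
    refine pow_ne_zero _ fun h0 ↦ ?_
    have h := X11b.R1.norm_one_sub_div_eq p (X11b.R1.not_dvd_lFunction_of_mult hfW hmult)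
    rw [← haW] at h
    rw [h0, norm_zero] at h
    have hp0 : (0 : ℝ) < p := by exact_mod_cast hp.pos
    linarith
  have hhQn0 : hQn ≠ 0 := by
    rw [hhQn]; exact_mod_cast (NumberField.classNumber_pos (K := K)).ne'
  -- dictionary between `em` and `algebraMap ℚ_p ℂ_p` on the shared atoms
  have hemh : em (NumberField.classNumber K : ℂ) = algebraMap ℚ_[p] ℂ_[p] hQn := by
    rw [map_natCast, hhQn, map_natCast]
  have hema : em ap = algebraMap ℚ_[p] ℂ_[p] aW := by
    rw [hapW, map_intCast, haW, map_intCast]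
  have hemAB : em (((A₀ * B : ℝ) : ℂ)) = em ((A₀ : ℂ) * (B : ℂ)) := by push_cast; rfl
  have hAB0 : em ((A₀ : ℂ) * (B : ℂ)) ≠ 0 := (map_ne_zero em).mpr (mul_ne_zero hA₀0 hB0)
  have hE30 : em E3 ≠ 0 :=
    (map_ne_zero em).mpr (by rw [hE3]; exact div_ne_zero (mul_ne_zero (mul_ne_zero hKc0 hC₁0) hπ0) hgc0)
  have hcCe : em cC = em ξ * em E3 * algebraMap ℚ_[p] ℂ_[p] (-aW) := by
    rw [hcC, hE3, show ξ * Kc * (C₁ : ℂ) * (Real.pi : ℂ) * -ap / gc =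
      ξ * (Kc * (C₁ : ℂ) * (Real.pi : ℂ) / gc) * (-ap) by ring, map_mul, map_mul, map_neg, hema, map_neg]
  -- the factor `X = alg((−a_W F)⁻¹)·em(A₀B)` of (L2) is non-zero; cancel it
  set X : ℂ_[p] := algebraMap ℚ_[p] ℂ_[p] ((-aW * F)⁻¹) * em ((A₀ : ℂ) * (B : ℂ)) with hXdef
  have hX0 : X ≠ 0 :=
    mul_ne_zero ((map_ne_zero _).mpr (inv_ne_zero (mul_ne_zero (neg_ne_zero.mpr haWQ0) hF0))) hAB0
  have hL2X : (s₂ : ℂ_[p]) * (algebraMap ℚ_[p] ℂ_[p] (hQn⁻¹ * Lg)) ^ 2 = a 0 * X := by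
    rw [hXdef, ← mul_assoc, ← hemAB, ← hem']
    exact hL2
  have hV2 : (algebraMap ℚ_[p] ℂ_[p] (((1 : ℚ_[p]) - ((W.LFunction p : ℤ) : ℚ_[p]) *
      (p : ℚ_[p])⁻¹) * Castella2018.padicLogOmega W p e P)) ^ 2 =
      algebraMap ℚ_[p] ℂ_[p] F * (algebraMap ℚ_[p] ℂ_[p] Lg) ^ 2 := by
    rw [← haW, ← hLg, map_mul, mul_pow, ← map_pow, ← hF]
  have haWC0 : algebraMap ℚ_[p] ℂ_[p] (-aW) ≠ 0 := (map_ne_zero _).mpr (neg_ne_zero.mpr haWQ0)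
  have hFC0 : algebraMap ℚ_[p] ℂ_[p] F ≠ 0 := (map_ne_zero _).mpr hF0
  have hhC0 : algebraMap ℚ_[p] ℂ_[p] hQn ≠ 0 := (map_ne_zero _).mpr hhQn0
  have hcCne : em cC ≠ 0 := (map_ne_zero em).mpr hcC0
  rw [hemh] at hunit'
  -- `em Q · em(A₀B) · em E3 = (alg h)⁻²`
  have hkey : em Q * em ((A₀ : ℂ) * (B : ℂ)) * em E3 = ((algebraMap ℚ_[p] ℂ_[p] hQn)⁻¹) ^ 2 := by
    rw [inv_pow]
    exact eq_inv_of_mul_eq_one_left hunit'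
  -- the main computation: `u·V²·X·c = s₂·alg(h⁻¹·Lg)²`
  have hfinal : u * (algebraMap ℚ_[p] ℂ_[p] (((1 : ℚ_[p]) - ((W.LFunction p : ℤ) : ℚ_[p]) *
      (p : ℚ_[p])⁻¹) * Castella2018.padicLogOmega W p e P)) ^ 2 * X * em cC =
      (s₂ : ℂ_[p]) * (algebraMap ℚ_[p] ℂ_[p] (hQn⁻¹ * Lg)) ^ 2 := by
    rw [hV2, hu, hXdef, hcCe, map_inv₀, map_mul (algebraMap ℚ_[p] ℂ_[p]) (-aW) F,
      map_mul (algebraMap ℚ_[p] ℂ_[p]) hQn⁻¹ Lg, map_inv₀]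
    calc (s₂ : ℂ_[p]) * em Q * (em ξ)⁻¹ * (algebraMap ℚ_[p] ℂ_[p] F * (algebraMap ℚ_[p] ℂ_[p] Lg) ^ 2) *
          ((algebraMap ℚ_[p] ℂ_[p] (-aW) * algebraMap ℚ_[p] ℂ_[p] F)⁻¹ *
            em ((A₀ : ℂ) * (B : ℂ))) * (em ξ * em E3 * algebraMap ℚ_[p] ℂ_[p] (-aW))
        = (s₂ : ℂ_[p]) * (algebraMap ℚ_[p] ℂ_[p] Lg) ^ 2 *
            (em Q * em ((A₀ : ℂ) * (B : ℂ)) * em E3) *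
            ((algebraMap ℚ_[p] ℂ_[p] (-aW) * algebraMap ℚ_[p] ℂ_[p] F) *
              (algebraMap ℚ_[p] ℂ_[p] (-aW) * algebraMap ℚ_[p] ℂ_[p] F)⁻¹) *
            (em ξ * (em ξ)⁻¹) := by ring
      _ = (s₂ : ℂ_[p]) * (algebraMap ℚ_[p] ℂ_[p] Lg) ^ 2 *
            ((algebraMap ℚ_[p] ℂ_[p] hQn)⁻¹) ^ 2 := by
          rw [mul_inv_cancel₀ (mul_ne_zero haWC0 hFC0), mul_one, mul_inv_cancel₀ hξem0, mul_one, hkey]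
      _ = (s₂ : ℂ_[p]) * ((algebraMap ℚ_[p] ℂ_[p] hQn)⁻¹ * algebraMap ℚ_[p] ℂ_[p] Lg) ^ 2 := by
          ring
  apply mul_right_cancel₀ hX0
  calc u * (algebraMap ℚ_[p] ℂ_[p] (((1 : ℚ_[p]) - ((W.LFunction p : ℤ) : ℚ_[p]) *
          (p : ℚ_[p])⁻¹) * Castella2018.padicLogOmega W p e P)) ^ 2 * X
      = (u * (algebraMap ℚ_[p] ℂ_[p] (((1 : ℚ_[p]) - ((W.LFunction p : ℤ) : ℚ_[p]) *
          (p : ℚ_[p])⁻¹) * Castella2018.padicLogOmega W p e P)) ^ 2 * X * em cC) * (em cC)⁻¹ := by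
        rw [mul_inv_cancel_right₀ hcCne]
    _ = (s₂ : ℂ_[p]) * (algebraMap ℚ_[p] ℂ_[p] (hQn⁻¹ * Lg)) ^ 2 * (em cC)⁻¹ := by rw [hfinal]
    _ = a 0 * X * (em cC)⁻¹ := by rw [hL2X]
    _ = a 0 * (em cC)⁻¹ * X := by ring

/-- **`LZZRoadInput ⟹ X2.BDPValueContinuousDisplayAt W p`** at every `W`, `p` (the input is sign-free and
`p`-free; the predicate's binders supply the datum: `X2.bdpValueContinuousDisplayAt_of_pointwise`). Hence
`stub_c2` of crux 4 BY NAME (`Reoriented.stub_c2_of_continuousDisplay_three`). CONDITIONAL on `LZZRoadInput`.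
[cite: LiuZhangZhang2018, Thm. 3.8 and Thm. 3.10 (arXiv:1511.08172 p. 18) (source of the input; nothing asserted)] -/
theorem bdpValueContinuousDisplayAt_of_lzzRoadInput (hL : LZZRoadInput)
    (W : WeierstrassCurve ℚ) [W.IsElliptic] [W.IsGloballyMinimal] (p : ℕ) [Fact p.Prime] :
    BDPValueContinuousDisplayAt W p :=
  bdpValueContinuousDisplayAt_of_pointwise fun ι K _ _ 𝔭 κ γ _ _ Dt H ιK e P f hp2 hmult hN hpN hp2N hK
    hd4 hsplit h𝔭 hι hHN _ hκ hγ hfW hcM hP _ he ↦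
    exists_continuousDisplay_of_lzzRoadInput hL ι W K 𝔭 κ γ Dt H ιK e P f hp2 hmult hN hpN hp2N hK hd4
      hsplit h𝔭 hι hHN hκ hγ hfW hcM hP he

end Rescale

end Summit.BirchSwinnertonDyer.Rank1Residual.X2

end
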